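import Literature.MathematicalPhysics.QuantumLattice.EmeryThreeBandRingWindowFloor
import HarnessLib

/-!
# The `Cu₂O₅` BAR WINDOW of the decorated `CuO₂` lattice (two corner-sharing `CuO₃` units): every interacting shape of the
# three-band interaction has an even translate inside it — a second turnkey 7-site Emery cluster floor

Topic `Literature/MathematicalPhysics/QuantumLattice` (family `hubbard`; crew hubbard-fast S2 (iv) «three-band Emery boxes», seat hubbard-box-p3
«covering statements»). Companion of `EmeryThreeBandRingWindowFloor` (hubbard-box-p1: the 7-site `Cu₃O₄` ring) and `EmeryThreeBandCuO4WindowFloor`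
(the 5-site plus). The BAR is the other 7-site window with the fit property: `W = {(0,2),(1,2),(2,2),(0,1),(0,3),(2,1),(2,3)}` — two Cu at `(0,2)`,
`(2,2)` bridged by the O_x at `(1,2)`, each Cu carrying its two O_y ligands (`(0,1),(0,3)` resp. `(2,1),(2,3)`); Fock dimension `4⁷`, largest spin
sector `1225` (the ring's class). WHY A SECOND 7-SITE WINDOW: the bar is mirror-symmetric in both axes, so its UNIFORM `(2ℤ)²`-weights are already the
optimal admissible weights, and in small-cluster numerics (seat table EMERY-WINDOWS-g18, floats) its uniform Anderson floor lies above the ring's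
uniform floor at every tested coupling and within `±0.1 eV/CuO₂` of the ring's OPTIMALLY WEIGHTED floor (e.g. La₂CuO₄ corner `(1.29, 0.46, 1.7, 0, 4.83,
3.39)`, 5 electrons/cell: plus `5.71`, ring `5.69 → 5.94` weighted, bar `5.83`; at `4.84` electrons/cell: plus `4.35`, ring `4.42 → 4.71`, bar `4.71`
eV/CuO₂) — the same certificate class as the ring, no weight bookkeeping.

* §1 `emeryBarWindow` and its coordinate description;
* §2 **`emeryBarWindow_fit`**: every interacting shape of `emeryInteraction θ` (classified in `EmeryThreeBandRingWindowFloor` §2) has an EVEN translate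
  inside `W` — all witnesses rooted at the Cu `(0,2)`, the O_x `(1,2)` or the O_y `(0,1)`;
* §3 **`le_emeryEnergyDensity_of_barCertificate`**: `M > 0`, any `G ∈ 𝔄_W` killed by `2×2`-periodic states and a certificate
  `H^{w}_W[emeryInteraction θ] + G − q₀·1 ⪰ 0` with the uniform `(2ℤ)²`-weight of mass `M` give `q₀/(4M) ≤ emeryEnergyDensity θ ρ`.

Definition with body: `emeryBarWindow`; everything else PROVED; no named fact, no number (the docstring floats are orientation, not claims).

## Mathlib / tree search

REUSED: `exists_shape_of_emeryInteraction_apply_ne_zero`, `le_emeryEnergyDensity_of_posSemidef_uniform`, `uniformPeriodicWeight` (`EmeryThreeBandRingWindowFloor`,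
`WeightedOpenClusterUniformWeightsPeriodic`); `mem_halfOpenBox`, `shiftSet_pair_eq`, `shiftSet_singleton_eq`, `InCoset`, `liebPeriods`, `cuSite/oxSite/oySite`,
`ppVec`, `unitVec`. `lean search 'emeryBar|barWindow|Cu2O5'` (2026-08-28): nothing; `EmeryThreeBandWindowFloors.le_emeryEnergyDensity_of_windowCertificate`
covers only windows CONTAINING the ring (the bar does not).

## References

* R. Valentí, J. Stolze, P. J. Hirschfeld, Phys. Rev. B 43 (1991) 13743, §II. [cite: ValentiStolzeHirschfeld1991, §II]
* P. W. Anderson, Phys. Rev. 83 (1951) 1260, eq. (2). [cite: Anderson1951, eq. (2)]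
* E. Pavarini et al., Phys. Rev. Lett. 87 (2001) 047003, eq. (1). [cite: PavariniEtAl2001, eq. (1)]
* H. Araki, H. Moriya, Rev. Math. Phys. 15 (2003) 93, §4.1. [cite: ArakiMoriya2003, §4.1 Def. 4.5]
-/

noncomputable section

open scoped ComplexOrder BigOperators
open Finset

namespace Literature.MathematicalPhysics.QuantumLattice

open Matrix HubbardWave0 Literature.Probability.LatticeModels ThermodynamicLimit
open scoped Matrix.Norms.L2Operator

/-! ### §1 The bar window -/

/-- **The `Cu₂O₅` bar window** `{(0,2),(1,2),(2,2)} ∪ {(0,1),(0,3),(2,1),(2,3)}` (Cu at `(0,2),(2,2)`, O_x at `(1,2)`, O_y at `(0,1),(0,3),(2,1),(2,3)`).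
[cite: ValentiStolzeHirschfeld1991, §II] -/
def emeryBarWindow : Finset (Site 2) :=
  (halfOpenBox 2 4).filter fun x => (x 1 = 2 ∧ x 0 ≤ 2) ∨ ((x 0 = 0 ∨ x 0 = 2) ∧ (x 1 = 1 ∨ x 1 = 3))

/-- Coordinates of the bar window. [cite: ValentiStolzeHirschfeld1991, §II] -/
theorem mem_emeryBarWindow_iff {x : Site 2} :
    x ∈ emeryBarWindow ↔ (∀ i, 0 ≤ x i ∧ x i < 4) ∧ ((x 1 = 2 ∧ x 0 ≤ 2) ∨ ((x 0 = 0 ∨ x 0 = 2) ∧ (x 1 = 1 ∨ x 1 = 3))) := by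
  rw [emeryBarWindow, Finset.mem_filter, mem_halfOpenBox]
  norm_num

/-- Membership by the two coordinates. [cite: ValentiStolzeHirschfeld1991, §II] -/
theorem mem_emeryBarWindow_of_coords {x : Site 2} {a b : ℤ} (h0 : x 0 = a) (h1 : x 1 = b)
    (h : ((0 ≤ a ∧ a < 4) ∧ (0 ≤ b ∧ b < 4)) ∧ ((b = 2 ∧ a ≤ 2) ∨ ((a = 0 ∨ a = 2) ∧ (b = 1 ∨ b = 3)))) : x ∈ emeryBarWindow := by
  rw [mem_emeryBarWindow_iff, Fin.forall_fin_two, h0, h1]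
  exact h

/-! ### §2 Every interacting shape has an even translate inside the bar -/

/-- From `InCoset (2,2) s₀ x` and the parities of `s − s₀`: `s − x ∈ (2ℤ)²` (local copy of the ring file's helper). [cite: ArakiMoriya2003, §4.1] -/
private theorem inCoset_zero_sub_of_inCoset' {s₀ s x : Site 2} (hx : InCoset liebPeriods s₀ x) (h0 : (s 0 - s₀ 0) % 2 = 0)
    (h1 : (s 1 - s₀ 1) % 2 = 0) : InCoset liebPeriods 0 (s - x) := by
  intro i
  have hxi := hx i
  have hq : ((liebPeriods i : ℕ) : ℤ) + 1 = 2 := by fin_cases i <;> simp [liebPeriods]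
  rw [hq] at hxi ⊢
  fin_cases i
  · simp only [Pi.sub_apply, Pi.zero_apply, sub_zero] at hxi ⊢
    simp only [Fin.zero_eta] at hxi ⊢
    omega
  · simp only [Pi.sub_apply, Pi.zero_apply, sub_zero] at hxi ⊢
    simp only [Fin.mk_one] at hxi ⊢
    omega

/-- `{x, x+u} + (s − x) = {s, s+u}`. [cite: ArakiMoriya2003, §4.1] -/
private theorem shiftSet_pair_sub' (x s u : Site 2) : shiftSet (s - x) ({x, x + u} : Finset (Site 2)) = {s, s + u} := by
  rw [shiftSet_pair_eq, add_sub_cancel, show x + u + (s - x) = s + u by abel]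

/-- `{x} + (s − x) = {s}`. [cite: ArakiMoriya2003, §4.1] -/
private theorem shiftSet_singleton_sub' (x s : Site 2) : shiftSet (s - x) ({x} : Finset (Site 2)) = {s} := by
  rw [shiftSet_singleton_eq, add_sub_cancel]

/-- A pair of bar sites is inside the bar. [cite: ValentiStolzeHirschfeld1991, §II] -/
private theorem pair_subset_bar {s u : Site 2} (hs : s ∈ emeryBarWindow) (hsu : s + u ∈ emeryBarWindow) :
    ({s, s + u} : Finset (Site 2)) ⊆ emeryBarWindow :=
  Finset.insert_subset hs (Finset.singleton_subset_iff.2 hsu)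

/-- The Cu root `(0,2)` of the bar. [cite: PavariniEtAl2001, eq. (1)] -/
private theorem cuRoot_mem : (cuSite + 2 • unitVec 1 : Site 2) ∈ emeryBarWindow :=
  mem_emeryBarWindow_of_coords (a := 0) (b := 2) (by simp [cuSite, unitVec]) (by simp [cuSite, unitVec]) (by norm_num)

/-- The O_x root `(1,2)` of the bar. [cite: PavariniEtAl2001, eq. (1)] -/
private theorem oxRoot_mem : (oxSite + 2 • unitVec 1 : Site 2) ∈ emeryBarWindow :=
  mem_emeryBarWindow_of_coords (a := 1) (b := 2) (by simp [oxSite, unitVec]) (by simp [oxSite, unitVec]) (by norm_num)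

/-- The O_y root `(0,1)` of the bar. [cite: PavariniEtAl2001, eq. (1)] -/
private theorem oyRoot_mem : (oySite : Site 2) ∈ emeryBarWindow :=
  mem_emeryBarWindow_of_coords (a := 0) (b := 1) (by simp [oySite, unitVec]) (by simp [oySite, unitVec]) (by norm_num)

/-- **`hfit` FOR THE BAR**: every interacting shape of the three-band interaction (at any `θ`) has an even translate inside the `Cu₂O₅` bar window.
[cite: ValentiStolzeHirschfeld1991, §II] -/
theorem emeryBarWindow_fit (θ : Fin 14 → ℝ) :
    ∀ (c : Cell liebPeriods) (X : Finset (Site 2)), cellPos c ∈ X → (emeryInteraction θ).Φ X ≠ 0 →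
      ∃ v : Site 2, InCoset liebPeriods 0 v ∧ shiftSet v X ⊆ emeryBarWindow := by
  intro c X _ hX
  have hcu : ∀ {x : Site 2}, InCoset liebPeriods cuSite x → InCoset liebPeriods 0 (cuSite + 2 • unitVec 1 - x) :=
    fun hc => inCoset_zero_sub_of_inCoset' hc (by simp [cuSite, unitVec]) (by simp [cuSite, unitVec])
  have hox : ∀ {x : Site 2}, InCoset liebPeriods oxSite x → InCoset liebPeriods 0 (oxSite + 2 • unitVec 1 - x) :=
    fun hc => inCoset_zero_sub_of_inCoset' hc (by simp [oxSite, unitVec]) (by simp [oxSite, unitVec])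
  have hoy : ∀ {x : Site 2}, InCoset liebPeriods oySite x → InCoset liebPeriods 0 (oySite - x) :=
    fun hc => inCoset_zero_sub_of_inCoset' hc (by rw [sub_self]; rfl) (by rw [sub_self]; rfl)
  rcases exists_shape_of_emeryInteraction_apply_ne_zero θ hX with ⟨x, rfl, hc⟩ | ⟨x, rfl, hc⟩ | ⟨x, k, rfl, hc⟩ | ⟨x, rfl, hc⟩
  · -- `e₁` bonds: from Cu put at `(0,2)` (`{(0,2),(1,2)}`), from O_x put at `(1,2)` (`{(1,2),(2,2)}`)
    rcases hc with hc | hc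
    · refine ⟨_, hcu hc, ?_⟩
      rw [shiftSet_pair_sub']
      exact pair_subset_bar cuRoot_mem
        (mem_emeryBarWindow_of_coords (a := 1) (b := 2) (by simp [cuSite, unitVec]) (by simp [cuSite, unitVec]) (by norm_num))
    · refine ⟨_, hox hc, ?_⟩
      rw [shiftSet_pair_sub']
      exact pair_subset_bar oxRoot_mem
        (mem_emeryBarWindow_of_coords (a := 2) (b := 2) (by simp [oxSite, unitVec]) (by simp [oxSite, unitVec]) (by norm_num))
  · -- `e₂` bonds: from Cu `{(0,2),(0,3)}`, from O_y `{(0,1),(0,2)}`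
    rcases hc with hc | hc
    · refine ⟨_, hcu hc, ?_⟩
      rw [shiftSet_pair_sub']
      exact pair_subset_bar cuRoot_mem
        (mem_emeryBarWindow_of_coords (a := 0) (b := 3) (by simp [cuSite, unitVec]) (by simp [cuSite, unitVec]) (by norm_num))
    · refine ⟨_, hoy hc, ?_⟩
      rw [shiftSet_pair_sub']
      exact pair_subset_bar oyRoot_mem
        (mem_emeryBarWindow_of_coords (a := 0) (b := 2) (by simp [oySite, unitVec]) (by simp [oySite, unitVec]) (by norm_num))
  · -- O_x–O_y bonds from `(1,2)`: `(2,3)`, `(0,3)`, `(2,1)`, `(0,1)`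
    refine ⟨_, hox hc, ?_⟩
    rw [shiftSet_pair_sub']
    refine pair_subset_bar oxRoot_mem ?_
    fin_cases k
    · exact mem_emeryBarWindow_of_coords (a := 2) (b := 3) (by simp [oxSite, unitVec, ppVec]) (by simp [oxSite, unitVec, ppVec]) (by norm_num)
    · exact mem_emeryBarWindow_of_coords (a := 0) (b := 3) (by simp [oxSite, unitVec, ppVec]) (by simp [oxSite, unitVec, ppVec]) (by norm_num)
    · exact mem_emeryBarWindow_of_coords (a := 2) (b := 1) (by simp [oxSite, unitVec, ppVec]) (by simp [oxSite, unitVec, ppVec]) (by norm_num)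
    · exact mem_emeryBarWindow_of_coords (a := 0) (b := 1) (by simp [oxSite, unitVec, ppVec]) (by simp [oxSite, unitVec, ppVec]) (by norm_num)
  · -- sites
    rcases hc with hc | hc | hc
    · exact ⟨_, hcu hc, by rw [shiftSet_singleton_sub', Finset.singleton_subset_iff]; exact cuRoot_mem⟩
    · exact ⟨_, hox hc, by rw [shiftSet_singleton_sub', Finset.singleton_subset_iff]; exact oxRoot_mem⟩
    · exact ⟨_, hoy hc, by rw [shiftSet_singleton_sub', Finset.singleton_subset_iff]; exact oyRoot_mem⟩

/-! ### §3 The turnkey bar floor -/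

namespace InfVolFermionState

/-- **THE TURNKEY EMERY BAR FLOOR.** For `M > 0`, any `G ∈ 𝔄_W` killed by every `2×2`-periodic state, and a cluster certificate
`H^{w}_W[emeryInteraction θ] + G − q₀·1 ⪰ 0` on the `Cu₂O₅` bar window `W` with the uniform `(2ℤ)²`-weight `w` of mass `M`:
`q₀/(4M) ≤ emeryEnergyDensity θ ρ` for every `ρ` with `emeryStates ρ` nonempty. [cite: Anderson1951, eq. (2)] [cite: ValentiStolzeHirschfeld1991, §II] -/
theorem le_emeryEnergyDensity_of_barCertificate (θ : Fin 14 → ℝ) {ρ : ℝ} (hS : (emeryStates ρ).Nonempty) {M : ℝ} (hM : 0 < M)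
    {G : FermionOp emeryBarWindow} (hG0 : ∀ ω' : InfVolFermionState 2, ω'.IsPeriodic liebPeriods → (ω'.expect emeryBarWindow G).re = 0)
    {q₀ : ℝ}
    (hq : ((⟨fun X => (uniformPeriodicWeight liebPeriods emeryBarWindow M X : ℂ) • (emeryInteraction θ).Φ X⟩ : FermionInteraction 2).localHamiltonian
      emeryBarWindow + G - (q₀ : ℂ) • (1 : FermionOp emeryBarWindow)).PosSemidef) :
    q₀ / (4 * M) ≤ emeryEnergyDensity θ ρ :=
  le_emeryEnergyDensity_of_posSemidef_uniform θ hS emeryBarWindow hM (emeryBarWindow_fit θ) hG0 hq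

/-- **Any window containing the bar** inherits the fit and the turnkey floor (uniform weights of THAT window).
[cite: ValentiStolzeHirschfeld1991, §II] -/
theorem le_emeryEnergyDensity_of_barSupersetCertificate (θ : Fin 14 → ℝ) {ρ : ℝ} (hS : (emeryStates ρ).Nonempty) {B : Finset (Site 2)}
    (hB : emeryBarWindow ⊆ B) {M : ℝ} (hM : 0 < M)
    {G : FermionOp B} (hG0 : ∀ ω' : InfVolFermionState 2, ω'.IsPeriodic liebPeriods → (ω'.expect B G).re = 0) {q₀ : ℝ}
    (hq : ((⟨fun X => (uniformPeriodicWeight liebPeriods B M X : ℂ) • (emeryInteraction θ).Φ X⟩ : FermionInteraction 2).localHamiltonian B + G -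
      (q₀ : ℂ) • (1 : FermionOp B)).PosSemidef) :
    q₀ / (4 * M) ≤ emeryEnergyDensity θ ρ :=
  le_emeryEnergyDensity_of_posSemidef_uniform θ hS B hM (fun c X hc hX => by
    obtain ⟨v, hv, hvW⟩ := emeryBarWindow_fit θ c X hc hX
    exact ⟨v, hv, hvW.trans hB⟩) hG0 hq

end InfVolFermionState

end Literature.MathematicalPhysics.QuantumLattice

end
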